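import Summits.ValiantsHypothesis.ValiantsHypothesis.Theorems.FreeSubtorusOrbitDimensionBoundStubDiagonalLiftsDivisible
import Literature.Computability.AlgebraicComplexity.PermanentIrreducible

/-!
# `OrbitDimensionBound` (stmt-ValiantsHypothesis-16133), rung line `square_covering` — stub `stub_diagonalLifts`,
# part 4: SATURATION of the relation lattice (the torus becomes divisible) and the registered stub

Fourth and last helper file for stub 2 `stub_diagonalLifts` of `Cruxes/OrbitDimensionBound/Lines/square_covering.lean`
(route `FreeSubtorus`).  Part 3 (`…StubDiagonalLiftsDivisible`) proved the stub under the extra hypothesis that the group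
`T_Λ = closure (torusGen n r Λ)` is `m`-divisible.  Here that hypothesis is earned by changing `Λ`:

* `exists_admissible_saturation` — for admissible `Λ` (`r` rows) there is an admissible `Λ'` (`r` rows: a basis of the
  SATURATION of the lattice spanned by `Λ`, from the Smith normal form of `span Λ ≤ ℤ^{[n] ⊔ [n]}`, padded with zero
  rows) such that every `(d, e)` satisfying the `Λ'`-relations satisfies the `Λ`-relations (`T_{Λ'} ⊆ T_Λ`) and the
  solution group of the `Λ'`-relations is `m`-DIVISIBLE for every `m ≥ 1` (roots are taken in the coordinates of the
  Smith basis `bM` of `ℤ^{[n] ⊔ [n]}`, in which `T_{Λ'}` is a coordinate subtorus);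
* **`stub_diagonalLifts`** — `Stmt.stub_diagonalLifts` VERBATIM with `torusGen`, `Admissible`, `HasDiagonalLifts`
  unfolded: restrict the equivariance of `B` from `T_Λ` to `T_{Λ'}` and apply `stub_diagonalLifts_of_divisible`.

Helper mode (`--supports stmt-ValiantsHypothesis-16133 --as helper`): the line `square_covering` is not the registered
skeleton of the item, so no stub credit moves; the skeleton's `sorry` closes by `exact SquareCovering.stub_diagonalLifts`.
Honest framing: a structural stub ([folklore]: King stability ⇒ Schur ⇒ projective torus representation ⇒ diagonal
lifts on the identity component) of a dormant rung line whose load-bearing core `stub_gradedPowerCount` is OPEN;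
`OrbitDimensionBound`, `FreeSubtorus` and VP ≠ VNP are OPEN and NOT moved by this file.

## References
* A. D. King, Quart. J. Math. 45 (1994), Prop. 3.1 — orientation only.
* [LandsbergRessayre2017] J. M. Landsberg, N. Ressayre, Differential Geom. Appl. 55 (2017), §3.3, §6.
-/

set_option linter.dupNamespace false

namespace Summit.ValiantsHypothesis.ValiantsHypothesis.Theorems.FreeSubtorusOrbitDimensionBound.SquareCovering

open Matrix MvPolynomial Finset Module.End
open Literature.Computability.AlgebraicComplexity LRPencil
open Summit.ValiantsHypothesis.ValiantsHypothesis.Theorems.FreeSubtorusConfusionCovering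
open Summit.ValiantsHypothesis.ValiantsHypothesis.Theorems.FreeSubtorusOrbitDimensionBound.SignCovering.PerSummand

/-! ### §1 Characters of the torus `(ℂˣ)^ι`: `∏_q x_q ^ χ(q)` -/

section Characters

variable {ι : Type*} [Fintype ι]

/-- `∏_k z ^ e_k = z ^ (Σ_k e_k)` for integer exponents. [folklore] -/
theorem prod_zpow_eq_zpow_sum {G κ : Type*} [CommGroup G] [DecidableEq κ] (z : G) (e : κ → ℤ) (s : Finset κ) :
    ∏ k ∈ s, z ^ e k = z ^ (∑ k ∈ s, e k) := by
  induction s using Finset.induction_on with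
  | empty => simp
  | insert a s ha ih => rw [Finset.prod_insert ha, Finset.sum_insert ha, ih, _root_.zpow_add]

/-- The pairing is additive in the character. [folklore] -/
theorem prod_zpow_add (x : ι → ℂˣ) (χ χ' : ι → ℤ) :
    ∏ q, x q ^ (χ + χ') q = (∏ q, x q ^ χ q) * ∏ q, x q ^ χ' q := by
  rw [← Finset.prod_mul_distrib]
  exact Finset.prod_congr rfl fun q _ => by rw [Pi.add_apply, _root_.zpow_add]

/-- The pairing is multiplicative in integer scalars. [folklore] -/
theorem prod_zpow_smul (x : ι → ℂˣ) (c : ℤ) (χ : ι → ℤ) :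
    ∏ q, x q ^ (c • χ) q = (∏ q, x q ^ χ q) ^ c := by
  rw [← Finset.prod_zpow]
  exact Finset.prod_congr rfl fun q _ => by rw [Pi.smul_apply, smul_eq_mul, mul_comm, _root_.zpow_mul]

/-- Characters trivial on `x` form a subgroup: triviality passes from a set to its `ℤ`-span. [folklore] -/
theorem prod_zpow_eq_one_of_mem_span (x : ι → ℂˣ) (S : Set (ι → ℤ)) (hS : ∀ χ ∈ S, ∏ q, x q ^ χ q = 1)
    {χ : ι → ℤ} (hχ : χ ∈ Submodule.span ℤ S) : ∏ q, x q ^ χ q = 1 := by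
  induction hχ using Submodule.span_induction with
  | mem χ h => exact hS χ h
  | zero => simp
  | add χ χ' _ _ h h' => rw [prod_zpow_add, h, h', mul_one]
  | smul c χ _ h => rw [prod_zpow_smul, h, _root_.one_zpow]

/-- **Exchange of exponents**: `∏_k (∏_i z_i ^ A k i) ^ b k = ∏_i z_i ^ (Σ_k b k A k i)`. [folklore] -/
theorem prod_prod_zpow_zpow {κ : Type*} [Fintype κ] [DecidableEq κ] (z : ι → ℂˣ) (A : κ → ι → ℤ) (b : κ → ℤ) :
    ∏ k, (∏ i, z i ^ A k i) ^ b k = ∏ i, z i ^ (∑ k, b k * A k i) := by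
  classical
  calc ∏ k, (∏ i, z i ^ A k i) ^ b k = ∏ k, ∏ i, z i ^ (b k * A k i) := by
        refine Finset.prod_congr rfl fun k _ => ?_
        rw [← Finset.prod_zpow]
        exact Finset.prod_congr rfl fun i _ => by rw [← _root_.zpow_mul, mul_comm]
    _ = ∏ i, ∏ k, z i ^ (b k * A k i) := Finset.prod_comm
    _ = ∏ i, z i ^ (∑ k, b k * A k i) := Finset.prod_congr rfl fun i _ => prod_zpow_eq_zpow_sum _ _ _

/-- Coordinates in a `ℤ`-basis: `Σ_k (bM.repr v k) · (bM k) q = v q`. [folklore] -/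
theorem sum_repr_mul_apply (bM : Module.Basis ι ℤ (ι → ℤ)) (v : ι → ℤ) (q : ι) :
    ∑ k, bM.repr v k * bM k q = v q := by
  have h := congrFun (bM.sum_repr v) q
  simpa [Finset.sum_apply, Pi.smul_apply, smul_eq_mul] using h

/-- Dual computation: `Σ_q v q · (bM.repr e_q) k = bM.repr v k`. [folklore] -/
theorem sum_mul_repr_single (bM : Module.Basis ι ℤ (ι → ℤ)) [DecidableEq ι] (v : ι → ℤ) (k : ι) :
    ∑ q, v q * bM.repr (Pi.single q 1) k = bM.repr v k := by
  have hv : v = ∑ q, v q • (Pi.single q 1 : ι → ℤ) := by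
    ext i; simp [Finset.sum_apply, Pi.single_apply]
  symm
  conv_lhs => rw [hv]
  rw [map_sum, Finsupp.coe_finsetSum, Finset.sum_apply]
  refine Finset.sum_congr rfl fun q _ => ?_
  rw [LinearEquiv.map_smul, Finsupp.smul_apply, smul_eq_mul]

end Characters

/-! ### §2 Saturating the relation lattice -/

section Saturation

variable {n r : ℕ}

/-- The split pairing `∏_k d^χ(inl k) · ∏_l e^χ(inr l)` is the pairing of `Sum.elim d e`. [folklore] -/
theorem split_prod_eq (d e : Fin n → ℂˣ) (χ : (Fin n ⊕ Fin n) → ℤ) :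
    (∏ k, d k ^ χ (Sum.inl k)) * (∏ l, e l ^ χ (Sum.inr l)) = ∏ q, Sum.elim d e q ^ χ q := by
  rw [Fintype.prod_sum_type]; rfl

/-- **Saturation.**  For admissible lattice data `Λ` (`r` rows with zero row- and column-sums) there is admissible
`Λ'` (`r` rows) such that (i) the `Λ'`-relations imply the `Λ`-relations (`T_{Λ'} ⊆ T_Λ`) and (ii) the solution group
of the `Λ'`-relations is `m`-divisible for every `m ≥ 1`.  (`Λ'` = the Smith-normal-form basis vectors `bM (f i)` of
the saturation of `span Λ`, padded with zeros; roots are extracted in the coordinates of the basis `bM` of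
`ℤ^{[n] ⊔ [n]}`.) [folklore] -/
theorem exists_admissible_saturation (Λ : Fin r → (Fin n ⊕ Fin n) → ℤ)
    (hΛ : ∀ i, (∑ k, Λ i (Sum.inl k)) = 0 ∧ (∑ l, Λ i (Sum.inr l)) = 0) (m : ℕ) (hm : 0 < m) :
    ∃ Λ' : Fin r → (Fin n ⊕ Fin n) → ℤ,
      (∀ i, (∑ k, Λ' i (Sum.inl k)) = 0 ∧ (∑ l, Λ' i (Sum.inr l)) = 0) ∧
      (∀ d e : Fin n → ℂˣ, (∀ i, (∏ k, d k ^ Λ' i (Sum.inl k)) * (∏ l, e l ^ Λ' i (Sum.inr l)) = 1) →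
        ∀ i, (∏ k, d k ^ Λ i (Sum.inl k)) * (∏ l, e l ^ Λ i (Sum.inr l)) = 1) ∧
      (∀ d e : Fin n → ℂˣ, (∀ i, (∏ k, d k ^ Λ' i (Sum.inl k)) * (∏ l, e l ^ Λ' i (Sum.inr l)) = 1) →
        ∃ d' e' : Fin n → ℂˣ, (∀ i, (∏ k, d' k ^ Λ' i (Sum.inl k)) * (∏ l, e' l ^ Λ' i (Sum.inr l)) = 1) ∧
          (∀ k, d' k ^ m = d k) ∧ (∀ l, e' l ^ m = e l)) := by
  classical
  -- Smith normal form of `N = span Λ ≤ ℤ^{ι}`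
  set N : Submodule ℤ ((Fin n ⊕ Fin n) → ℤ) := Submodule.span ℤ (Set.range Λ) with hN
  obtain ⟨n₀, snf⟩ := Submodule.smithNormalForm (Pi.basisFun ℤ (Fin n ⊕ Fin n)) N
  set bM := snf.bM with hbM
  set bN := snf.bN with hbN
  set f := snf.f with hf
  set a := snf.a with ha
  have hsnf : ∀ i, (bN i : (Fin n ⊕ Fin n) → ℤ) = a i • bM (f i) := snf.snf
  -- `n₀ ≤ r`
  have hn₀ : n₀ ≤ r := by
    have h1 : Module.finrank ℤ N = n₀ := by rw [Module.finrank_eq_card_basis bN, Fintype.card_fin]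
    have h2 := finrank_range_le_card (R := ℤ) Λ
    rw [Set.finrank] at h2
    rw [← h1, hN]; simpa using h2
  -- `a i ≠ 0`
  have ha0 : ∀ i, a i ≠ 0 := by
    intro i hai
    have h := hsnf i
    rw [hai, zero_smul] at h
    exact bN.ne_zero i (Subtype.ext h)
  -- elements of `N` have zero row- and column-sums, and lie in the span of the `bM (f i)`
  have hNsums : ∀ y ∈ N, (∑ k, y (Sum.inl k)) = 0 ∧ (∑ l, y (Sum.inr l)) = 0 := by
    intro y hy
    induction hy using Submodule.span_induction with
    | mem y h => obtain ⟨i, rfl⟩ := h; exact hΛ i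
    | zero => simp
    | add y y' _ _ h h' =>
      simp only [Pi.add_apply, Finset.sum_add_distrib, h.1, h'.1, h.2, h'.2, add_zero, and_self]
    | smul c y _ h =>
      simp only [Pi.smul_apply, smul_eq_mul, ← Finset.mul_sum, h.1, h.2, mul_zero, and_self]
  -- the new data
  let Λ' : Fin r → (Fin n ⊕ Fin n) → ℤ := fun j => if h : (j : ℕ) < n₀ then bM (f ⟨j, h⟩) else 0
  have hΛ'lt : ∀ (j : Fin r) (h : (j : ℕ) < n₀), Λ' j = bM (f ⟨j, h⟩) := fun j h => by simp [Λ', h]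
  have hΛ'ge : ∀ (j : Fin r), ¬ (j : ℕ) < n₀ → Λ' j = 0 := fun j h => by simp [Λ', h]
  refine ⟨Λ', fun j => ?_, fun d e hrel i => ?_, fun d e hrel => ?_⟩
  · -- admissibility
    by_cases h : (j : ℕ) < n₀
    · rw [hΛ'lt j h]
      have hmem : (bN ⟨j, h⟩ : (Fin n ⊕ Fin n) → ℤ) ∈ N := (bN ⟨j, h⟩).2
      have hs := hNsums _ hmem
      rw [hsnf] at hs
      simp only [Pi.smul_apply, smul_eq_mul, ← Finset.mul_sum, mul_eq_zero, ha0, false_or] at hs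
      exact hs
    · rw [hΛ'ge j h]; simp
  · -- `T_{Λ'} ⊆ T_Λ`
    rw [split_prod_eq]
    refine prod_zpow_eq_one_of_mem_span (Sum.elim d e) (Set.range fun i : Fin n₀ => (bM (f i) : (Fin n ⊕ Fin n) → ℤ))
      ?_ ?_
    · rintro χ ⟨i', rfl⟩
      have hi' : ((⟨i', lt_of_lt_of_le i'.2 hn₀⟩ : Fin r) : ℕ) < n₀ := i'.2
      have h := hrel ⟨i', lt_of_lt_of_le i'.2 hn₀⟩
      rw [hΛ'lt _ hi', split_prod_eq] at h
      exact h
    · -- `Λ i ∈ N ⊆ span {bM (f i')}`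
      have hmem : Λ i ∈ N := Submodule.subset_span ⟨i, rfl⟩
      have hrepr := bN.sum_repr (⟨Λ i, hmem⟩ : N)
      have hcoe : Λ i = ∑ i', bN.repr ⟨Λ i, hmem⟩ i' • (bN i' : (Fin n ⊕ Fin n) → ℤ) := by
        have h1 := congrArg Subtype.val hrepr
        rw [Submodule.coe_sum] at h1
        simp only [Submodule.coe_smul_of_tower] at h1
        exact h1.symm
      rw [hcoe]
      refine Submodule.sum_mem _ fun i' _ => Submodule.smul_mem _ _ ?_
      rw [hsnf]
      exact Submodule.smul_mem _ _ (Submodule.subset_span ⟨i', rfl⟩)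
  · -- divisibility
    set x : (Fin n ⊕ Fin n) → ℂˣ := Sum.elim d e with hx
    have hrel' : ∀ i' : Fin n₀, ∏ q, x q ^ (bM (f i') q) = 1 := by
      intro i'
      have h := hrel ⟨i', lt_of_lt_of_le i'.2 hn₀⟩
      rw [hΛ'lt _ i'.2, split_prod_eq] at h
      exact h
    -- coordinates `y` and their roots `z`
    let y : (Fin n ⊕ Fin n) → ℂˣ := fun t => ∏ q, x q ^ (bM t q)
    have hroot : ∀ t, ∃ w : ℂˣ, w ^ m = y t ∧ (t ∈ Set.range f → w = 1) := by
      intro t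
      by_cases ht : t ∈ Set.range f
      · obtain ⟨i', rfl⟩ := ht
        exact ⟨1, by rw [one_pow]; exact (hrel' i').symm, fun _ => rfl⟩
      · obtain ⟨w, hw⟩ := IsAlgClosed.exists_pow_nat_eq ((y t : ℂˣ) : ℂ) hm
        have hw0 : w ≠ 0 := by
          intro h0; rw [h0, zero_pow hm.ne'] at hw; exact (y t).ne_zero hw.symm
        refine ⟨Units.mk0 w hw0, Units.ext ?_, fun h => absurd h ht⟩
        rw [Units.val_pow_eq_pow_val, Units.val_mk0, hw]
    choose z hz hz1 using hroot
    -- the root `x'` in the original coordinates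
    let x' : (Fin n ⊕ Fin n) → ℂˣ := fun q => ∏ t, z t ^ (bM.repr (Pi.single q 1) t)
    have hx'pow : ∀ q, x' q ^ m = x q := by
      intro q
      have h1 : x' q ^ m = ∏ t, (z t ^ m) ^ (bM.repr (Pi.single q 1) t) := by
        simp only [x']
        rw [← Finset.prod_pow]
        refine Finset.prod_congr rfl fun t _ => ?_
        rw [← zpow_natCast, ← zpow_natCast, ← _root_.zpow_mul, ← _root_.zpow_mul, mul_comm]
      rw [h1]
      simp_rw [hz]
      -- `∏_t (∏_q' x q' ^ bM t q') ^ repr(e_q) t = ∏_q' x q' ^ (Σ_t repr(e_q) t · bM t q') = x q`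
      rw [prod_prod_zpow_zpow]
      have : ∀ q', (∑ t, bM.repr (Pi.single q 1) t * bM t q') = (Pi.single q 1 : (Fin n ⊕ Fin n) → ℤ) q' :=
        fun q' => sum_repr_mul_apply bM _ q'
      simp_rw [this]
      rw [Finset.prod_eq_single q]
      · simp
      · intro q' _ hq'; rw [Pi.single_apply, if_neg hq', zpow_zero]
      · intro h; exact absurd (Finset.mem_univ q) h
    have hx'rel : ∀ i' : Fin n₀, ∏ q, x' q ^ (bM (f i') q) = 1 := by
      intro i'
      simp only [x']
      rw [prod_prod_zpow_zpow]
      have : ∀ t, (∑ q, bM (f i') q * bM.repr (Pi.single q 1) t) = bM.repr (bM (f i')) t :=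
        fun t => sum_mul_repr_single bM _ t
      simp_rw [this, bM.repr_self]
      rw [Finset.prod_eq_single (f i')]
      · simp [hz1 _ ⟨i', rfl⟩]
      · intro t _ ht; simp [Ne.symm ht]
      · intro h; exact absurd (Finset.mem_univ _) h
    refine ⟨fun k => x' (Sum.inl k), fun l => x' (Sum.inr l), fun j => ?_, fun k => ?_, fun l => ?_⟩
    · by_cases h : (j : ℕ) < n₀
      · rw [hΛ'lt j h, split_prod_eq]
        have : Sum.elim (fun k => x' (Sum.inl k)) (fun l => x' (Sum.inr l)) = x' := by
          ext q; cases q <;> rfl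
        rw [this]
        exact hx'rel ⟨j, h⟩
      · rw [hΛ'ge j h]; simp
    · have := hx'pow (Sum.inl k); simpa [hx] using this
    · have := hx'pow (Sum.inr l); simpa [hx] using this

end Saturation

/-! ### §3 The torus generated by the relations, and the registered stub -/

section Stub

variable {n r : ℕ}

/-- The diagonal matrix `diag(d_k e_l)` of a pair of unit vectors, as an element of `GL(n²)`. [folklore] -/
theorem det_diagonal_units_ne_zero (d e : Fin n → ℂˣ) :
    (Matrix.diagonal (fun p : Fin n × Fin n => (d p.1 : ℂ) * (e p.2 : ℂ))).det ≠ 0 := by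
  rw [Matrix.det_diagonal]
  exact Finset.prod_ne_zero_iff.2 fun p _ => mul_ne_zero (d p.1).ne_zero (e p.2).ne_zero

/-- **The set `torusGen` is a group**: every element of the subgroup it generates is again of the form `diag(d_k e_l)`
with `(d, e)` satisfying the relations. [folklore] -/
theorem mem_torusGen_of_mem_closure (Λ : Fin r → (Fin n ⊕ Fin n) → ℤ) (γ : GL (Fin n × Fin n) ℂ)
    (hγ : γ ∈ Subgroup.closure {γ : Matrix.GeneralLinearGroup (Fin n × Fin n) ℂ |
          ∃ d e : Fin n → ℂˣ, (∀ i, (∏ k, (d k) ^ (Λ i (Sum.inl k))) * (∏ l, (e l) ^ (Λ i (Sum.inr l))) = 1) ∧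
            (γ : Matrix (Fin n × Fin n) (Fin n × Fin n) ℂ) = Matrix.diagonal (fun p => (d p.1 : ℂ) * (e p.2 : ℂ))}) :
    ∃ d e : Fin n → ℂˣ, (∀ i, (∏ k, (d k) ^ (Λ i (Sum.inl k))) * (∏ l, (e l) ^ (Λ i (Sum.inr l))) = 1) ∧
      (γ : Matrix (Fin n × Fin n) (Fin n × Fin n) ℂ) = Matrix.diagonal (fun p => (d p.1 : ℂ) * (e p.2 : ℂ)) := by
  refine Subgroup.closure_induction (p := fun (γ : GL (Fin n × Fin n) ℂ) (_ : γ ∈ Subgroup.closure {γ : Matrix.GeneralLinearGroup (Fin n × Fin n) ℂ |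
          ∃ d e : Fin n → ℂˣ, (∀ i, (∏ k, (d k) ^ (Λ i (Sum.inl k))) * (∏ l, (e l) ^ (Λ i (Sum.inr l))) = 1) ∧
            (γ : Matrix (Fin n × Fin n) (Fin n × Fin n) ℂ) = Matrix.diagonal (fun p => (d p.1 : ℂ) * (e p.2 : ℂ))}) =>
      ∃ d e : Fin n → ℂˣ, (∀ i, (∏ k, (d k) ^ (Λ i (Sum.inl k))) * (∏ l, (e l) ^ (Λ i (Sum.inr l))) = 1) ∧
        (γ : Matrix (Fin n × Fin n) (Fin n × Fin n) ℂ) = Matrix.diagonal (fun p => (d p.1 : ℂ) * (e p.2 : ℂ)))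
    ?_ ?_ ?_ ?_ hγ
  · intro γ h; exact h
  · refine ⟨1, 1, fun i => by simp, ?_⟩
    rw [Units.val_one]; ext p q; simp [Matrix.one_apply, Matrix.diagonal_apply]
  · rintro γ δ _ _ ⟨d, e, hde, hγ⟩ ⟨d', e', hde', hδ⟩
    refine ⟨d * d', e * e', fun i => ?_, ?_⟩
    · have h1 := hde i
      have h2 := hde' i
      simp only [Pi.mul_apply, mul_zpow, Finset.prod_mul_distrib]
      calc (∏ k, d k ^ Λ i (Sum.inl k)) * (∏ k, d' k ^ Λ i (Sum.inl k)) *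
            ((∏ l, e l ^ Λ i (Sum.inr l)) * ∏ l, e' l ^ Λ i (Sum.inr l))
          = ((∏ k, d k ^ Λ i (Sum.inl k)) * ∏ l, e l ^ Λ i (Sum.inr l)) *
            ((∏ k, d' k ^ Λ i (Sum.inl k)) * ∏ l, e' l ^ Λ i (Sum.inr l)) := by
              simp only [mul_assoc, mul_left_comm]
        _ = 1 := by rw [h1, h2, mul_one]
    · rw [Units.val_mul, hγ, hδ, Matrix.diagonal_mul_diagonal]
      congr 1; ext p; simp only [Pi.mul_apply, Units.val_mul]; ring
  · rintro γ _ ⟨d, e, hde, hγ⟩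
    refine ⟨d⁻¹, e⁻¹, fun i => ?_, ?_⟩
    · have h1 := hde i
      simp only [Pi.inv_apply, _root_.inv_zpow, Finset.prod_inv_distrib]
      rw [← mul_inv, h1, inv_one]
    · rw [Matrix.coe_units_inv, hγ]
      refine Matrix.inv_eq_right_inv ?_
      rw [Matrix.diagonal_mul_diagonal, ← Matrix.diagonal_one]
      congr 1; ext p
      simp only [Pi.inv_apply, Units.val_inv_eq_inv_val]
      field_simp

/-- **Registered stub 2 of the line `square_covering` (`Stmt.stub_diagonalLifts`, VERBATIM with `torusGen`, `Admissible`
and `HasDiagonalLifts` unfolded):** a block-indecomposable affine determinantal representation `B` of `per_n ^ j`,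
exactly equivariant under the torus `T_Λ` (`Λ` admissible with `r` generators), can be replaced by an equivalent
representation of the same size whose lifts over an admissible `Λ'` (a basis of the saturation of `ℤΛ`, `T_{Λ'}` = the
identity component of `T_Λ`) are all DIAGONAL.  (King-stable ⇒ Schurian ⇒ lifts unique up to scalars and semisimple
⇒ over the divisible torus `T_{Λ'}` they commute ⇒ one joint eigenbasis on each side.)
[cite: King1994, Prop. 3.1] [cite: LandsbergRessayre2017, §3, §6] -/
theorem stub_diagonalLifts :
    ∀ (n j m r : ℕ) (Λ : Fin r → (Fin n ⊕ Fin n) → ℤ) (B : Matrix (Fin m) (Fin m) (MvPolynomial (Fin n × Fin n) ℂ)),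
      3 ≤ n → 1 ≤ j → (∀ i, (∑ k, Λ i (Sum.inl k)) = 0 ∧ (∑ l, Λ i (Sum.inr l)) = 0) →
      IsEquivariantDetRepr (Subgroup.closure {γ : Matrix.GeneralLinearGroup (Fin n × Fin n) ℂ |
          ∃ d e : Fin n → ℂˣ, (∀ i, (∏ k, (d k) ^ (Λ i (Sum.inl k))) * (∏ l, (e l) ^ (Λ i (Sum.inr l))) = 1) ∧
            (γ : Matrix (Fin n × Fin n) (Fin n × Fin n) ℂ) = Matrix.diagonal (fun p => (d p.1 : ℂ) * (e p.2 : ℂ))})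
        (perPoly (Fin n) ℂ ^ j) B →
      ¬ IsBlockDecomposable B →
      ∃ (Λ' : Fin r → (Fin n ⊕ Fin n) → ℤ) (B' : Matrix (Fin m) (Fin m) (MvPolynomial (Fin n × Fin n) ℂ)),
        (∀ i, (∑ k, Λ' i (Sum.inl k)) = 0 ∧ (∑ l, Λ' i (Sum.inr l)) = 0) ∧
        IsAffineDetRepr (perPoly (Fin n) ℂ ^ j) B' ∧
        ∀ γ ∈ Subgroup.closure {γ : Matrix.GeneralLinearGroup (Fin n × Fin n) ℂ |
          ∃ d e : Fin n → ℂˣ, (∀ i, (∏ k, (d k) ^ (Λ' i (Sum.inl k))) * (∏ l, (e l) ^ (Λ' i (Sum.inr l))) = 1) ∧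
            (γ : Matrix (Fin n × Fin n) (Fin n × Fin n) ℂ) = Matrix.diagonal (fun p => (d p.1 : ℂ) * (e p.2 : ℂ))},
          ∃ u v : Fin m → ℂˣ,
            Matrix.linSubstEntries γ B' =
              (Matrix.diagonal fun i => C (u i : ℂ)) * B' * Matrix.diagonal fun i => C (v i : ℂ) := by
  intro n j m r Λ B hn hj hΛ hB hnb
  classical
  haveI : Nonempty (Fin n) := ⟨⟨0, by omega⟩⟩
  have hper : Irreducible (perPoly (Fin n) ℂ) := perPoly_irreducible
  -- `m ≥ 1`
  have hm : 0 < m := by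
    rcases Nat.eq_zero_or_pos m with h0 | h0
    · exfalso
      subst h0
      have h1 : B.det = 1 := Matrix.det_isEmpty
      have h2 := hB.1.2
      rw [h1] at h2
      have h3 : IsUnit (perPoly (Fin n) ℂ ^ j) := h2 ▸ isUnit_one
      exact hper.not_isUnit ((isUnit_pow_iff (by omega)).1 h3)
    · exact h0
  obtain ⟨Λ', hΛ', hsub, hdiv⟩ := exists_admissible_saturation Λ hΛ m hm
  -- equivariance restricts to the smaller torus
  have hle : Subgroup.closure {γ : Matrix.GeneralLinearGroup (Fin n × Fin n) ℂ |
          ∃ d e : Fin n → ℂˣ, (∀ i, (∏ k, (d k) ^ (Λ' i (Sum.inl k))) * (∏ l, (e l) ^ (Λ' i (Sum.inr l))) = 1) ∧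
            (γ : Matrix (Fin n × Fin n) (Fin n × Fin n) ℂ) = Matrix.diagonal (fun p => (d p.1 : ℂ) * (e p.2 : ℂ))} ≤
      Subgroup.closure {γ : Matrix.GeneralLinearGroup (Fin n × Fin n) ℂ |
          ∃ d e : Fin n → ℂˣ, (∀ i, (∏ k, (d k) ^ (Λ i (Sum.inl k))) * (∏ l, (e l) ^ (Λ i (Sum.inr l))) = 1) ∧
            (γ : Matrix (Fin n × Fin n) (Fin n × Fin n) ℂ) = Matrix.diagonal (fun p => (d p.1 : ℂ) * (e p.2 : ℂ))} := by
    refine Subgroup.closure_mono ?_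
    rintro γ ⟨d, e, hde, hγ⟩
    exact ⟨d, e, hsub d e hde, hγ⟩
  have hB' := hB.anti hle
  -- the smaller torus is `m`-divisible
  have hdiv' : ∀ γ ∈ Subgroup.closure {γ : Matrix.GeneralLinearGroup (Fin n × Fin n) ℂ |
          ∃ d e : Fin n → ℂˣ, (∀ i, (∏ k, (d k) ^ (Λ' i (Sum.inl k))) * (∏ l, (e l) ^ (Λ' i (Sum.inr l))) = 1) ∧
            (γ : Matrix (Fin n × Fin n) (Fin n × Fin n) ℂ) = Matrix.diagonal (fun p => (d p.1 : ℂ) * (e p.2 : ℂ))},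
      ∃ δ ∈ Subgroup.closure {γ : Matrix.GeneralLinearGroup (Fin n × Fin n) ℂ |
          ∃ d e : Fin n → ℂˣ, (∀ i, (∏ k, (d k) ^ (Λ' i (Sum.inl k))) * (∏ l, (e l) ^ (Λ' i (Sum.inr l))) = 1) ∧
            (γ : Matrix (Fin n × Fin n) (Fin n × Fin n) ℂ) = Matrix.diagonal (fun p => (d p.1 : ℂ) * (e p.2 : ℂ))}, δ ^ m = γ := by
    intro γ hγ
    obtain ⟨d, e, hde, hγe⟩ := mem_torusGen_of_mem_closure Λ' γ hγ
    obtain ⟨d', e', hde', hd', he'⟩ := hdiv d e hde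
    refine ⟨Matrix.GeneralLinearGroup.mkOfDetNeZero _ (det_diagonal_units_ne_zero d' e'),
      Subgroup.subset_closure ⟨d', e', hde', by rw [Matrix.GeneralLinearGroup.val_mkOfDetNeZero]⟩, ?_⟩
    apply Units.ext
    rw [Units.val_pow_eq_pow_val, Matrix.GeneralLinearGroup.val_mkOfDetNeZero, Matrix.diagonal_pow, hγe]
    congr 1; ext p
    simp only [Pi.pow_apply, mul_pow, ← Units.val_pow_eq_pow_val, hd', he']
  exact stub_diagonalLifts_of_divisible n j m r Λ' B hn hj hΛ' hB' hnb hdiv'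

end Stub

end Summit.ValiantsHypothesis.ValiantsHypothesis.Theorems.FreeSubtorusOrbitDimensionBound.SquareCovering
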